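import Summits.QuantumFields.BalabanUV.Beta.GAN24.E3UnitSplitSum
import Summits.QuantumFields.BalabanUV.Beta.SpineRootedSc

/-!
# `BalabanUV.Beta.GAN24.E3UnitSplitLevelsVAt` — binder row G-an2-4 / (CONV-C), road S3 AT THE IN-BLOCK ROOT, V half: package (ρV-b0) of «ROOTED-S3-V»
# (OWNER gan24-p1-g21 (W11) «GO NOW, WANTED»; `gen21/BORNV-PLAN-v0.md` §3) — **THE THREE (V-H) UNIT TEMPLATES OF leaf-01's `E3UnitSplitLevels` ∕ `E3UnitSplitSum`
# (`e3VH_unit_split`, `e3VHTop_unit_split`, `e3VH0_unit_split`) FOR an1's ROOTED (V-H) TABLE `vhSAt ρ` AND an2's ROOTED BORDER INCREMENT `SpineRootedSc.borderIncAt d ρ`**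
# (any root `ρ`; the generic template `e3VH_unit_split_of` BY NAME — only the off-diagonality of the rooted pieces is re-checked), plus the `ρ = 0` bridges
# (`borderIncAt_zero` ∕ `vhSAt_zero`).  The Λ twins are leaf-01 g60's `E3UnitSplitLevelsAt` (p295996).

NOT IN PRINT; OUR BOOKKEEPING (unit `b2b-balaban-gan24-p2`, gen 33 = prover-b2b-balaban-gan24-p2-g33-0, road-P2 chair of row G-an2-4; CRUX TEAM (2), 2026-08-21; mkroot METHOD:
same statements with `borderInc d Lc ↦ borderIncAt d ρ Lc`, `vhS d Lc ↦ vhSAt ρ d Lc`, names `…_at`; base modules untouched).  [folklore]; 0 `def`, 0 cited facts, 0 `def … : Prop`,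
0 sorry; NO estimate of Bałaban's.  HONEST FRAMING (cell contract, verbatim): «discharging `BetaPertH` makes Bałaban's UV stability UNCONDITIONAL — a real constructive-QFT
result; it is NOT the continuum limit and NOT the Clay problem.»  HONEST DEPENDENCY (verbatim): «continuum YM on T⁴ ⇐ BetaPertH ∧ nine spine estimates (0/9 proved); BetaPertH
⇐ (D1) ∧ (D4) ∧ CAP+tail; G-an2-4 gates asym, D1 and NE2/3/4.»

## What (generic `d`; ANY root `ρ`)
* §1 blocks: `vh0At_inl_inl ∕ _inr_inr`, `borderIncAt_inl_inl ∕ _inr_inr`, `pushSum_vh0At_inl_inl ∕ _inr_inr`, `pushSum_borderIncAt_inl_inl ∕ _inr_inr` (the rooted (V-H) pieces are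
  off-diagonal: an1's `packVH` has no ff ∕ mm block at any root).
* §2 templates: **`e3VH_unit_split_at`** (level `ℓ ≥ 1` pushed `k` times: `P = pushSum (Lc^(ℓ+1)) (Lc^k) (borderIncAt d ρ Lc (Lc^ℓ) κ u)`), **`e3VHTop_unit_split_at`** (`k = 0`),
  **`e3VH0_unit_split_at`** (birth `0`: `P = pushSum Lc (Lc^k) (mfNeg (vhSAt ρ d Lc κ u))`) — statements = the base templates symbol for symbol with the rooted pieces.
* §3 bridges `e3VH_template_lhs_zero_root` ∕ `e3VH0_template_lhs_zero_root` (at `ρ = 0` the rooted left-hand sides ARE the base ones).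
USE: (ρV-b) `TaylorRowVAt`, (ρV-c) `S3ShapeVtAt` ∕ `S3RowV0At` read these where the base rows read `E3UnitSplit.e3VH*_unit_split`.  Discharges NOTHING of (hS, hSall) ∕ hB; NEVER
«G-an2-4 closed»; NOT D1, NOT BetaPertH, NOT continuum, NOT Clay.
-/

noncomputable section

open Finset
open scoped BigOperators
open Literature.MathematicalPhysics.QuantumFieldTheory
open Literature.MathematicalPhysics.QuantumFieldTheory.Balaban1983to89
open Literature.MathematicalPhysics.QuantumFieldTheory.Balaban1983to89.Beta
open ExpKernelCalculus (MKer)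
open KernelSpecInstance (wH wΦ)
open KKTFluctuationKernel (GamΦ)
open OneStepResolventKernel (Fib KInv)
open StepJetData (mfNeg)
open InterLevelTransport (avgLift)
open AveragingHessianKernels (vhS packVH_inl_inl packVH_inr_inr)
open AveragingHessianKernelsRooted (vhSAt vhSAt_zero)
open BalabanCompositeJets (pushSum pushSum_inl_inl borderInc)
open Summit.QuantumFields.BalabanUV.Beta.SpineRooted (borderIncAt borderIncAt_zero)
open Summit.QuantumFields.BalabanUV.Beta.GAN24.E3UnitSplit (e3OfS pushSum_block_zero avgLift_block_zero e3VH_unit_split_of)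

namespace Summit.QuantumFields.BalabanUV.Beta.GAN24.E3UnitSplitLevelsVAt

variable {d : ℕ}

/-! ## §1 The rooted (V-H) pieces are off-diagonal -/

section Blocks

variable {Lc : ℕ}

/-- [folklore] The rooted `S₀` (V-H) stencil has no field–field block (an1's `packVH`, any root). -/
theorem vh0At_inl_inl (ρ : Fin (d + 1) → ℤ) (κ : Fin (d + 1)) (u x z : Fin (d + 1) → ℤ) (α β : Fin (d + 1)) :
    mfNeg (vhSAt ρ d Lc rfl κ u) x z (Sum.inl α) (Sum.inl β) = 0 := by
  rw [StepJetData.mfNeg_inl_inl]; exact packVH_inl_inl _ Lc κ u x z α β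

/-- [folklore] … and no multiplier–multiplier block. -/
theorem vh0At_inr_inr (ρ : Fin (d + 1) → ℤ) (κ : Fin (d + 1)) (u x z : Fin (d + 1) → ℤ) (μ ν : Fin (d + 1)) :
    mfNeg (vhSAt ρ d Lc rfl κ u) x z (Sum.inr μ) (Sum.inr ν) = 0 := by
  rw [StepJetData.mfNeg_inr_inr]; exact packVH_inr_inr _ Lc κ u x z μ ν

/-- [folklore] **THE ROOTED BORDER INCREMENT IS OFF-DIAGONAL**: no field–field block … -/
theorem borderIncAt_inl_inl (ρ : Fin (d + 1) → ℤ) {M : ℕ} (κ : Fin (d + 1)) (u x z : Fin (d + 1) → ℤ) (α β : Fin (d + 1)) :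
    borderIncAt d ρ Lc M κ u x z (Sum.inl α) (Sum.inl β) = 0 := by
  simp only [borderIncAt]
  exact Finset.sum_eq_zero fun s _ => avgLift_block_zero _ _ _ (fun x z => vh0At_inl_inl ρ κ _ x z α β) x z

/-- [folklore] … and no multiplier–multiplier block. -/
theorem borderIncAt_inr_inr (ρ : Fin (d + 1) → ℤ) {M : ℕ} (κ : Fin (d + 1)) (u x z : Fin (d + 1) → ℤ) (μ ν : Fin (d + 1)) :
    borderIncAt d ρ Lc M κ u x z (Sum.inr μ) (Sum.inr ν) = 0 := by
  simp only [borderIncAt]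
  exact Finset.sum_eq_zero fun s _ => avgLift_block_zero _ _ _ (fun x z => vh0At_inr_inr ρ κ _ x z μ ν) x z

/-- [folklore] A pushed rooted `S₀` (V-H) stencil is off-diagonal (ff). -/
theorem pushSum_vh0At_inl_inl (ρ : Fin (d + 1) → ℤ) {M L : ℕ} (κ : Fin (d + 1)) (u x z : Fin (d + 1) → ℤ) (α β : Fin (d + 1)) :
    pushSum M L (mfNeg (vhSAt ρ d Lc rfl κ u)) x z (Sum.inl α) (Sum.inl β) = 0 := by
  rw [pushSum_inl_inl, vh0At_inl_inl]

/-- [folklore] A pushed rooted `S₀` (V-H) stencil is off-diagonal (mm). -/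
theorem pushSum_vh0At_inr_inr (ρ : Fin (d + 1) → ℤ) {M L : ℕ} (κ : Fin (d + 1)) (u x z : Fin (d + 1) → ℤ) (μ ν : Fin (d + 1)) :
    pushSum M L (mfNeg (vhSAt ρ d Lc rfl κ u)) x z (Sum.inr μ) (Sum.inr ν) = 0 :=
  pushSum_block_zero _ _ _ (fun x z => vh0At_inr_inr ρ κ u x z μ ν) x z

/-- [folklore] A pushed rooted border increment is off-diagonal (ff). -/
theorem pushSum_borderIncAt_inl_inl (ρ : Fin (d + 1) → ℤ) {M L M' : ℕ} (κ : Fin (d + 1)) (u x z : Fin (d + 1) → ℤ) (α β : Fin (d + 1)) :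
    pushSum M L (borderIncAt d ρ Lc M' κ u) x z (Sum.inl α) (Sum.inl β) = 0 := by
  rw [pushSum_inl_inl, borderIncAt_inl_inl]

/-- [folklore] A pushed rooted border increment is off-diagonal (mm). -/
theorem pushSum_borderIncAt_inr_inr (ρ : Fin (d + 1) → ℤ) {M L M' : ℕ} (κ : Fin (d + 1)) (u x z : Fin (d + 1) → ℤ) (μ ν : Fin (d + 1)) :
    pushSum M L (borderIncAt d ρ Lc M' κ u) x z (Sum.inr μ) (Sum.inr ν) = 0 :=
  pushSum_block_zero _ _ _ (fun x z => borderIncAt_inr_inr ρ κ u x z μ ν) x z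

end Blocks

/-! ## §2 The three rooted (V-H) templates -/

section Levels

variable {Lc : ℕ} [NeZero Lc]

/-- [folklore] **THE ROOTED (V-H) TEMPLATE, LEVEL `ℓ ≥ 1`, PUSHED `k` TIMES** (any root `ρ`): `P = pushSum (Lc^{ℓ+1}) (Lc^k) (borderIncAt d ρ Lc (Lc^ℓ) κ u)` in leaf-01's
`e3VH_unit_split_of` — the base `e3VH_unit_split` symbol for symbol with the rooted increment. -/
theorem e3VH_unit_split_at (ρ : Fin (d + 1) → ℤ) (cVH : ℝ) (ℓ k p : ℕ) (hp : p = ℓ + k + 1) (κ' : Fin (d + 1)) (u' x' z' : Fin (d + 1) → ℤ) (α β : Fin (d + 1)) :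
    ((Lc : ℝ) ^ p) ^ (2 * (d + 1)) *
        e3OfS (Lc ^ p) (fun κ u => (((Lc : ℝ) ^ (d + 1)) ^ k * (cVH * ((Lc : ℝ) ^ ℓ) ^ (d + 2))) • pushSum (Lc ^ (ℓ + 1)) (Lc ^ k) (borderIncAt d ρ Lc (Lc ^ ℓ) κ u)) κ' u' x' z' (Sum.inl α) (Sum.inl β) =
      -(cVH / (Lc : ℝ) ^ (d + 1)) * ((Lc : ℝ) ^ p) ^ (-(2 : ℤ)) * (Lc : ℝ) ^ ℓ *
        ∑' y : Fin (d + 1) → ℤ,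
          ((∑ l' : Fin (d + 1),
            (∑' w : Fin (d + 1) → ℤ, ∑ l : Fin (d + 1),
                (((Lc : ℝ) ^ p) ^ (2 * (d + 1)) * KInv (N := Lc ^ p) (d := d) (((Lc ^ p : ℕ) : ℤ) • x') w (Sum.inr α) (Sum.inr l)) *
                ∑ κ'' : Fin (d + 1), (((Lc : ℝ) ^ p) ^ (d + 1))⁻¹ * ∑' u : Fin (d + 1) → ℤ,
                  (((Lc : ℝ) ^ p) ^ (d + 2) * wH (N := Lc ^ p) κ'' κ' (u - ((Lc ^ p : ℕ) : ℤ) • u')) *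
                    pushSum (Lc ^ (ℓ + 1)) (Lc ^ k) (borderIncAt d ρ Lc (Lc ^ ℓ) κ'' u) w y (Sum.inr l) (Sum.inl l')) *
              (((Lc : ℝ) ^ p) ^ (d + 2) * wH (N := Lc ^ p) l' β (y - ((Lc ^ p : ℕ) : ℤ) • z'))) +
          ∑ l' : Fin (d + 1),
            (∑' w : Fin (d + 1) → ℤ, ∑ l : Fin (d + 1),
                (((Lc : ℝ) ^ p) ^ (d + 2) * GamΦ (N := Lc ^ p) α x' l w) *
                ∑ κ'' : Fin (d + 1), (((Lc : ℝ) ^ p) ^ (d + 1))⁻¹ * ∑' u : Fin (d + 1) → ℤ,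
                  (((Lc : ℝ) ^ p) ^ (d + 2) * wH (N := Lc ^ p) κ'' κ' (u - ((Lc ^ p : ℕ) : ℤ) • u')) *
                    pushSum (Lc ^ (ℓ + 1)) (Lc ^ k) (borderIncAt d ρ Lc (Lc ^ ℓ) κ'' u) w y (Sum.inl l) (Sum.inr l')) *
              (((Lc : ℝ) ^ p) ^ (2 * (d + 1)) *
                KInv (N := Lc ^ p) (d := d) y (((Lc ^ p : ℕ) : ℤ) • z') (Sum.inr l') (Sum.inr β))) :=
  e3VH_unit_split_of (Lc := Lc) (fun κ u => pushSum (Lc ^ (ℓ + 1)) (Lc ^ k) (borderIncAt d ρ Lc (Lc ^ ℓ) κ u))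
    (fun κ u x z α β => pushSum_borderIncAt_inl_inl ρ κ u x z α β) (fun κ u x z μ ν => pushSum_borderIncAt_inr_inr ρ κ u x z μ ν)
    cVH ℓ k p hp κ' u' x' z' α β

/-- [folklore] **THE ROOTED (V-H) TEMPLATE, TOP LEVEL** (`k = 0`: the unpushed rooted top border increment, natural weight `cVH·M^{d+2}`, member `p = ℓ+1`). -/
theorem e3VHTop_unit_split_at (ρ : Fin (d + 1) → ℤ) (cVH : ℝ) (ℓ p : ℕ) (hp : p = ℓ + 1) (κ' : Fin (d + 1)) (u' x' z' : Fin (d + 1) → ℤ) (α β : Fin (d + 1)) :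
    ((Lc : ℝ) ^ p) ^ (2 * (d + 1)) *
        e3OfS (Lc ^ p) (fun κ u => (cVH * ((Lc : ℝ) ^ ℓ) ^ (d + 2)) • borderIncAt d ρ Lc (Lc ^ ℓ) κ u) κ' u' x' z' (Sum.inl α) (Sum.inl β) =
      -(cVH / (Lc : ℝ) ^ (d + 1)) * ((Lc : ℝ) ^ p) ^ (-(2 : ℤ)) * (Lc : ℝ) ^ ℓ *
        ∑' y : Fin (d + 1) → ℤ,
          ((∑ l' : Fin (d + 1),
            (∑' w : Fin (d + 1) → ℤ, ∑ l : Fin (d + 1),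
                (((Lc : ℝ) ^ p) ^ (2 * (d + 1)) * KInv (N := Lc ^ p) (d := d) (((Lc ^ p : ℕ) : ℤ) • x') w (Sum.inr α) (Sum.inr l)) *
                ∑ κ'' : Fin (d + 1), (((Lc : ℝ) ^ p) ^ (d + 1))⁻¹ * ∑' u : Fin (d + 1) → ℤ,
                  (((Lc : ℝ) ^ p) ^ (d + 2) * wH (N := Lc ^ p) κ'' κ' (u - ((Lc ^ p : ℕ) : ℤ) • u')) *
                    borderIncAt d ρ Lc (Lc ^ ℓ) κ'' u w y (Sum.inr l) (Sum.inl l')) *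
              (((Lc : ℝ) ^ p) ^ (d + 2) * wH (N := Lc ^ p) l' β (y - ((Lc ^ p : ℕ) : ℤ) • z'))) +
          ∑ l' : Fin (d + 1),
            (∑' w : Fin (d + 1) → ℤ, ∑ l : Fin (d + 1),
                (((Lc : ℝ) ^ p) ^ (d + 2) * GamΦ (N := Lc ^ p) α x' l w) *
                ∑ κ'' : Fin (d + 1), (((Lc : ℝ) ^ p) ^ (d + 1))⁻¹ * ∑' u : Fin (d + 1) → ℤ,
                  (((Lc : ℝ) ^ p) ^ (d + 2) * wH (N := Lc ^ p) κ'' κ' (u - ((Lc ^ p : ℕ) : ℤ) • u')) *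
                    borderIncAt d ρ Lc (Lc ^ ℓ) κ'' u w y (Sum.inl l) (Sum.inr l')) *
              (((Lc : ℝ) ^ p) ^ (2 * (d + 1)) *
                KInv (N := Lc ^ p) (d := d) y (((Lc ^ p : ℕ) : ℤ) • z') (Sum.inr l') (Sum.inr β))) := by
  simpa only [pow_zero, one_mul] using
    e3VH_unit_split_of (Lc := Lc) (fun κ u => borderIncAt d ρ Lc (Lc ^ ℓ) κ u) (fun κ u x z α β => borderIncAt_inl_inl ρ κ u x z α β)
      (fun κ u x z μ ν => borderIncAt_inr_inr ρ κ u x z μ ν) cVH ℓ 0 p (by simpa using hp) κ' u' x' z' α β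

/-- [folklore] **THE ROOTED (V-H) TEMPLATE, LEVEL `0`, PUSHED `k` TIMES** (`S₀`'s rooted (V-H) stencil, natural weight `(Lc^{d+1})^k·cVH`, member `p = k+1`; `M = 1`):
`P = pushSum Lc (Lc^k) (mfNeg (vhSAt ρ d Lc κ u))` — the base `E3UnitSplitSum.e3VH0_unit_split` symbol for symbol with an1's rooted table. -/
theorem e3VH0_unit_split_at (ρ : Fin (d + 1) → ℤ) (cVH : ℝ) (k p : ℕ) (hp : p = k + 1) (κ' : Fin (d + 1)) (u' x' z' : Fin (d + 1) → ℤ) (α β : Fin (d + 1)) :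
    ((Lc : ℝ) ^ p) ^ (2 * (d + 1)) *
        e3OfS (Lc ^ p) (fun κ u => (((Lc : ℝ) ^ (d + 1)) ^ k * cVH) • pushSum Lc (Lc ^ k) (mfNeg (vhSAt ρ d Lc rfl κ u))) κ' u' x' z' (Sum.inl α) (Sum.inl β) =
      -(cVH / (Lc : ℝ) ^ (d + 1)) * ((Lc : ℝ) ^ p) ^ (-(2 : ℤ)) *
        ∑' y : Fin (d + 1) → ℤ,
          ((∑ l' : Fin (d + 1),
            (∑' w : Fin (d + 1) → ℤ, ∑ l : Fin (d + 1),
                (((Lc : ℝ) ^ p) ^ (2 * (d + 1)) * KInv (N := Lc ^ p) (d := d) (((Lc ^ p : ℕ) : ℤ) • x') w (Sum.inr α) (Sum.inr l)) *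
                ∑ κ'' : Fin (d + 1), (((Lc : ℝ) ^ p) ^ (d + 1))⁻¹ * ∑' u : Fin (d + 1) → ℤ,
                  (((Lc : ℝ) ^ p) ^ (d + 2) * wH (N := Lc ^ p) κ'' κ' (u - ((Lc ^ p : ℕ) : ℤ) • u')) *
                    pushSum Lc (Lc ^ k) (mfNeg (vhSAt ρ d Lc rfl κ'' u)) w y (Sum.inr l) (Sum.inl l')) *
              (((Lc : ℝ) ^ p) ^ (d + 2) * wH (N := Lc ^ p) l' β (y - ((Lc ^ p : ℕ) : ℤ) • z'))) +
          ∑ l' : Fin (d + 1),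
            (∑' w : Fin (d + 1) → ℤ, ∑ l : Fin (d + 1),
                (((Lc : ℝ) ^ p) ^ (d + 2) * GamΦ (N := Lc ^ p) α x' l w) *
                ∑ κ'' : Fin (d + 1), (((Lc : ℝ) ^ p) ^ (d + 1))⁻¹ * ∑' u : Fin (d + 1) → ℤ,
                  (((Lc : ℝ) ^ p) ^ (d + 2) * wH (N := Lc ^ p) κ'' κ' (u - ((Lc ^ p : ℕ) : ℤ) • u')) *
                    pushSum Lc (Lc ^ k) (mfNeg (vhSAt ρ d Lc rfl κ'' u)) w y (Sum.inl l) (Sum.inr l')) *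
              (((Lc : ℝ) ^ p) ^ (2 * (d + 1)) *
                KInv (N := Lc ^ p) (d := d) y (((Lc ^ p : ℕ) : ℤ) • z') (Sum.inr l') (Sum.inr β))) := by
  simpa only [pow_zero, one_pow, mul_one] using
    e3VH_unit_split_of (Lc := Lc) (fun κ u => pushSum Lc (Lc ^ k) (mfNeg (vhSAt ρ d Lc rfl κ u)))
      (fun κ u x z α β => pushSum_vh0At_inl_inl ρ κ u x z α β) (fun κ u x z μ ν => pushSum_vh0At_inr_inr ρ κ u x z μ ν) cVH 0 k p (by simpa using hp)
      κ' u' x' z' α β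

/-! ## §3 Bridges at the corner root -/

omit [NeZero Lc] in
/-- [folklore] At `ρ = 0` the rooted pushed increment IS the base one (`borderIncAt_zero`): the template left-hand sides agree. -/
theorem e3VH_template_lhs_zero_root (ℓ k : ℕ) (κ : Fin (d + 1)) (u : Fin (d + 1) → ℤ) :
    pushSum (Lc ^ (ℓ + 1)) (Lc ^ k) (borderIncAt d 0 Lc (Lc ^ ℓ) κ u) = pushSum (Lc ^ (ℓ + 1)) (Lc ^ k) (borderInc d Lc (Lc ^ ℓ) κ u) := by
  rw [borderIncAt_zero]

omit [NeZero Lc] in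
/-- [folklore] At `ρ = 0` the rooted `S₀` (V-H) stencil IS the base one (`vhSAt_zero`). -/
theorem e3VH0_template_lhs_zero_root (k : ℕ) (κ : Fin (d + 1)) (u : Fin (d + 1) → ℤ) :
    pushSum Lc (Lc ^ k) (mfNeg (vhSAt (0 : Fin (d + 1) → ℤ) d Lc rfl κ u)) = pushSum Lc (Lc ^ k) (mfNeg (vhS d Lc κ u)) := by
  rw [vhSAt_zero]

end Levels

end Summit.QuantumFields.BalabanUV.Beta.GAN24.E3UnitSplitLevelsVAt

end
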